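import Literature.NumberTheory.Sieve.PretentiousDistanceProofs
import Literature.NumberTheory.Sieve.MatomakiRadziwillLemma11Tools
import Literature.NumberTheory.LFunctions.PretentiousDistanceFord
import HarnessLib

/-!
# Pretentious distances of sifted functions (uniform lower bounds, complex case)

Topic `Literature/NumberTheory/LFunctions`.  Everything in this file is PROVED (the last corollary is
conditional on the named fact `zeta_bound_ford`, exactly as `PretentiousDistanceFord.lean`).

Let `f : ℕ → ℂ` be `1`-bounded and let `φ` be `f` SIFTED by a set of primes `R`: `φ(p) = 0` for `p ∈ R`
and `φ(p) = f(p)` for primes `p ∉ R` (only prime values enter the Granville–Soundararajan distance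
`𝔻(·,·;x)² = Sieve.pretentiousDistSq`).  Write `K_R(x) = ∑_{p ≤ x, p ∈ R} 1/p` (kept inline as
`∑ p ∈ (Nat.primesLE ⌊x⌋₊).filter (· ∈ R), 1/p`; no new definition).  For
arbitrary `1`-bounded "targets" `u, v : ℕ → ℂ` we prove the termwise inequalities

* `sum_inv_le_pretentiousDistSq_sifted` : `K_R ≤ 𝔻(φ,u)²`;
* `pretentiousDistSq_le_sifted_add_sum_inv` : `𝔻(f,u)² ≤ 𝔻(φ,u)² + K_R` (sifting lowers a
  distance by at most `K_R`);
* `pretentiousDistSq_le_two_mul_sifted` : `𝔻(f,u)² ≤ 2 𝔻(φ,u)²` (the "halved distance");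
* `pretentiousDistSq_le_four_mul_sifted_add` (key) :
  `𝔻(v,u)² ≤ 4 𝔻(φ,u)² + 2 K_R + 2 (𝔻(f,v)² − 𝔻(f,u)²)`, from the squared pointwise triangle
  inequality `1 − Re(v ū) ≤ 2(1 − Re(v z̄)) + 2(1 − Re(z ū))` on the closed unit disc;
* `pretentiousDistSq_le_six_mul_sifted_add` : `𝔻(v,u)² ≤ 6 𝔻(φ,u)² + 2 (𝔻(f,v)² − 𝔻(f,u)²)`.

With `u = n^{it}`, `v = n^{it₁}` where `t₁` is a `δ`-near-minimiser of `u ↦ 𝔻(f, n^{iu}; x)²` relative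
to the point `t` (`𝔻(f, n^{it₁})² ≤ 𝔻(f, n^{it})² + δ`; a true minimiser over `|u| ≤ T` exists and realises
`Sieve.minPretentiousDistSq f x T`: `Halasz.Restricted.exists_isMinOn_pretentiousDistSq_twist`,
`HalaszRestrictedOffMinimiser.lean`) and `pretentiousDistSq_twist_twist`
(`𝔻(n^{it₁}, n^{it})² = 𝔻(1, n^{i(t−t₁)})²`) this gives, for every sieve `R` at once,

* `sifted_twist_ge_sixth` : `𝔻(φ, n^{it}; x)² ≥ 𝔻(1, n^{i(t−t₁)}; x)²/6 − δ/3`, and hence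
* `sifted_twist_ge_loglog_of_ford` : `𝔻(φ, n^{it}; x)² ≥ (1/18) log log x − C_A − δ/3` for
  `2 ≤ |t − t₁| ≤ x^A` (`PretentiousFord.pretentiousDistSq_one_twist_ge`, i.e. Matomäki–Radziwiłł's
  Lemma 2 input `𝔻(1, n^{iτ}; x)² ≥ (1/3) log log x − C`).

Companion file: `HalaszRestrictedOffMinimiser.lean` proves the analogous (and, for blocks of small primes,
loss-free) bounds for the HALVED distance `𝔻_½` of block-RESTRICTED sums (`Halasz.Restricted.halfDistSq`,
weight `½` on the blocks); here the primes of `R` carry weight `0` (a genuine sieve, e.g. the large-prime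
range `[P, Q]` of Matomäki–Radziwiłł §8.3 / Lemma 3, or the blocks removed by Lemma 5), for which the
sifted distance can be SMALLER than `𝔻(f, ·)²` and the bounds below are what survives uniformly.

## Why (the use in Matomäki–Radziwiłł–Tao 2015, Appendix A)

For REAL `f`, Matomäki–Radziwiłł (Ann. of Math. 183 (2016), Lemma 2) bound `𝔻(g, n^{it})²` below for
every real `1`-bounded `g` uniformly (`2𝔻(g, p^{it}) ≥ 𝔻(1, p^{2it})`), so Lemma 3 there applies to each
of the `2^J` sifted functions `f g_𝒥` of their Lemma 5 (inclusion–exclusion removing the restriction to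
`𝒮`).  For COMPLEX `f` the printed argument of MRT Appendix A (proof of Proposition A.3 and Lemma A.4:
"`2𝔻(f, p^{it}) ≥ 𝔻(f, p^{it}) + 𝔻(f, p^{it₁}) ≥ 𝔻(1, p^{i(t−t₁)})`") uses the minimiser `t₁ = t₁(f)`,
and the minimisers of the sifted pieces `f g_𝒥` differ from `t₁(f)`; moreover sifting by `R` can LOWER
`𝔻(f, n^{it})²` by `K_R`, which for the interval systems of Appendix A is not small.  The bounds of this
file are uniform in `R` and are stated relative to `t₁(f)`: they are what lets the Appendix-A argument run
for the sifted pieces (the obstruction recorded as (i) in the module docstring of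
`MatomakiRadziwillTaoPropA3.lean`).  They are elementary and not in the sources in this form.

## References
* K. Matomäki, M. Radziwiłł, T. Tao, *An averaged form of Chowla's conjecture*, Algebra & Number Theory
  9 (2015), Appendix A, proof of Proposition A.3 and Lemma A.4 (arXiv:1503.05121 §6).
* K. Matomäki, M. Radziwiłł, Ann. of Math. (2) 183 (2016), §2, Lemmas 2, 3, 5.
* A. Granville, K. Soundararajan, *Pretentious multiplicative functions and an inequality for the
  zeta-function*, CRM Proc. Lecture Notes 46 (2008), §2 (the triangle inequality; tree:
  `Sieve.sqrt_one_sub_re_mul_conj_le`).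

## Design choices
* `R : Finset ℕ`; the sifted function is any `φ : ℕ → ℂ` with `φ p = 0` on `R` and `φ p = f p` at
  primes off `R` (so `φ = f · 1_{(n, ∏R) = 1}`, `MatomakiRadziwillL3.siftedTwist`, … all qualify).
* Twists are written `fun n : ℕ => (n : ℂ) ^ ((t : ℂ) * I)` as in `Sieve.minPretentiousDistSq`.
* Minimality of `t₁` is asked only relative to the point `t`, with a slack `δ` (as in
  `HalaszRestrictedOffMinimiser.lean`); no `minPretentiousDistSq` in the statements, so the imports stay
  light (`PretentiousDistanceProofs`, `MatomakiRadziwillLemma11Tools` for `conj n^s = n^{conj s}`, and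
  `PretentiousDistanceFord` for the last corollary); `‖n^{it}‖ ≤ 1` is a local `have`.
-/

noncomputable section

open Complex Finset
open scoped ComplexConjugate

namespace Literature.NumberTheory.LFunctions

namespace PretentiousSifted

open Literature.NumberTheory.Sieve (pretentiousDistSq pretentiousDistSq_nonneg sqrt_one_sub_re_mul_conj_le)
open Literature.NumberTheory.Sieve.MatomakiRadziwillL11 (conj_natCast_cpow)

/-! ### Pointwise inequalities on the closed unit disc -/

/-- `Re (z w̄) ≤ 1` for `|z|, |w| ≤ 1`. [folklore] -/
theorem re_mul_conj_le_one {z w : ℂ} (hz : ‖z‖ ≤ 1) (hw : ‖w‖ ≤ 1) : (z * conj w).re ≤ 1 :=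
  calc (z * conj w).re ≤ ‖z * conj w‖ := Complex.re_le_norm _
    _ = ‖z‖ * ‖w‖ := by rw [norm_mul, Complex.norm_conj]
    _ ≤ 1 * 1 := mul_le_mul hz hw (norm_nonneg _) zero_le_one
    _ = 1 := one_mul 1

/-- `-1 ≤ Re (z w̄)` for `|z|, |w| ≤ 1`, i.e. `1 - Re (z w̄) ≤ 2`. [folklore] -/
theorem neg_one_le_re_mul_conj {z w : ℂ} (hz : ‖z‖ ≤ 1) (hw : ‖w‖ ≤ 1) : -1 ≤ (z * conj w).re := by
  have h1 : |(z * conj w).re| ≤ ‖z * conj w‖ := Complex.abs_re_le_norm _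
  have h2 : ‖z * conj w‖ ≤ 1 := by
    rw [norm_mul, Complex.norm_conj]
    calc ‖z‖ * ‖w‖ ≤ 1 * 1 := mul_le_mul hz hw (norm_nonneg _) zero_le_one
      _ = 1 := one_mul 1
  have := (abs_le.1 (h1.trans h2)).1
  linarith

/-- **Squared triangle inequality on the closed unit disc**: for `|z|, |v|, |w| ≤ 1`,
`1 − Re(z w̄) ≤ 2 (1 − Re(z v̄)) + 2 (1 − Re(v w̄))` (square
`√(1 − Re z w̄) ≤ √(1 − Re z v̄) + √(1 − Re v w̄)` and use `2ab ≤ a² + b²`). [folklore] -/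
theorem one_sub_re_le_two_mul_add {z v w : ℂ} (hz : ‖z‖ ≤ 1) (hv : ‖v‖ ≤ 1) (hw : ‖w‖ ≤ 1) :
    1 - (z * conj w).re ≤ 2 * (1 - (z * conj v).re) + 2 * (1 - (v * conj w).re) := by
  have ha : 0 ≤ 1 - (z * conj w).re := sub_nonneg.2 (re_mul_conj_le_one hz hw)
  have hb : 0 ≤ 1 - (z * conj v).re := sub_nonneg.2 (re_mul_conj_le_one hz hv)
  have hc : 0 ≤ 1 - (v * conj w).re := sub_nonneg.2 (re_mul_conj_le_one hv hw)
  have h := sqrt_one_sub_re_mul_conj_le hz hv hw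
  have hsq : 1 - (z * conj w).re ≤ (√(1 - (z * conj v).re) + √(1 - (v * conj w).re)) ^ 2 := by
    calc 1 - (z * conj w).re = (√(1 - (z * conj w).re)) ^ 2 := (Real.sq_sqrt ha).symm
      _ ≤ _ := pow_le_pow_left₀ (Real.sqrt_nonneg _) h 2
  nlinarith [Real.sq_sqrt hb, Real.sq_sqrt hc, Real.sqrt_nonneg (1 - (z * conj v).re),
    Real.sqrt_nonneg (1 - (v * conj w).re),
    sq_nonneg (√(1 - (z * conj v).re) - √(1 - (v * conj w).re))]

/-! ### The mass of the sieve and the sifted function -/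

variable {f φ u v : ℕ → ℂ} {R : Finset ℕ} {x : ℝ}

/-- A function sifted from a `1`-bounded `f` is `1`-bounded at primes. [folklore] -/
theorem norm_sifted_prime_le (hf : ∀ n, ‖f n‖ ≤ 1) (hR : ∀ p ∈ R, φ p = 0)
    (hRc : ∀ p, p.Prime → p ∉ R → φ p = f p) {p : ℕ} (hp : p.Prime) : ‖φ p‖ ≤ 1 := by
  by_cases hpR : p ∈ R
  · rw [hR p hpR, norm_zero]; exact zero_le_one
  · rw [hRc p hp hpR]; exact hf p

/-- **The sieve mass is a lower bound**: `K_R(x) ≤ 𝔻(φ, u; x)²` for `φ` vanishing on `R`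
(each `p ∈ R` contributes `(1 − Re 0)/p = 1/p`, the other summands are `≥ 0`). [folklore] -/
theorem sum_inv_le_pretentiousDistSq_sifted (hf : ∀ n, ‖f n‖ ≤ 1) (hu : ∀ n, ‖u n‖ ≤ 1)
    (hR : ∀ p ∈ R, φ p = 0) (hRc : ∀ p, p.Prime → p ∉ R → φ p = f p) :
    (∑ p ∈ (Nat.primesLE ⌊x⌋₊).filter (· ∈ R), 1 / (p : ℝ)) ≤ pretentiousDistSq φ u x := by
  rw [Finset.sum_filter, pretentiousDistSq]
  refine Finset.sum_le_sum fun p hp => ?_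
  have hpp : p.Prime := Nat.prime_of_mem_primesLE hp
  by_cases hpR : p ∈ R
  · rw [if_pos hpR, hR p hpR]; simp
  · rw [if_neg hpR]
    refine div_nonneg (sub_nonneg.2 (re_mul_conj_le_one ?_ (hu p))) (Nat.cast_nonneg p)
    rw [hRc p hpp hpR]; exact hf p

/-- **Sifting lowers a distance by at most the sieve mass**: `𝔻(f, u; x)² ≤ 𝔻(φ, u; x)² + K_R(x)`
(at `p ∈ R`: `1 − Re f(p)ū(p) ≤ 2 = (1 − Re 0) + 1`). [folklore] -/
theorem pretentiousDistSq_le_sifted_add_sum_inv (hf : ∀ n, ‖f n‖ ≤ 1) (hu : ∀ n, ‖u n‖ ≤ 1)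
    (hR : ∀ p ∈ R, φ p = 0) (hRc : ∀ p, p.Prime → p ∉ R → φ p = f p) :
    pretentiousDistSq f u x ≤ pretentiousDistSq φ u x + (∑ p ∈ (Nat.primesLE ⌊x⌋₊).filter (· ∈ R), 1 / (p : ℝ)) := by
  rw [Finset.sum_filter, pretentiousDistSq, pretentiousDistSq, ← Finset.sum_add_distrib]
  refine Finset.sum_le_sum fun p hp => ?_
  have hpp : p.Prime := Nat.prime_of_mem_primesLE hp
  have hp0 : (0 : ℝ) < p := by exact_mod_cast hpp.pos
  by_cases hpR : p ∈ R
  · rw [if_pos hpR, hR p hpR, zero_mul, Complex.zero_re, sub_zero, ← add_div]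
    refine div_le_div_of_nonneg_right ?_ hp0.le
    linarith [neg_one_le_re_mul_conj (hf p) (hu p)]
  · rw [if_neg hpR, hRc p hpp hpR, add_zero]

/-- **The halved distance**: `𝔻(f, u; x)² ≤ 2 𝔻(φ, u; x)²`, i.e. sifting (anywhere) at most halves
the squared distance to any `1`-bounded target (at `p ∈ R`: `1 − Re f(p)ū(p) ≤ 2 = 2(1 − Re 0)`; cf.
`Halasz.Restricted.minHalfDistSq_ge_half` for the restricted-sum analogue). [folklore] -/
theorem pretentiousDistSq_le_two_mul_sifted (hf : ∀ n, ‖f n‖ ≤ 1) (hu : ∀ n, ‖u n‖ ≤ 1)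
    (hR : ∀ p ∈ R, φ p = 0) (hRc : ∀ p, p.Prime → p ∉ R → φ p = f p) :
    pretentiousDistSq f u x ≤ 2 * pretentiousDistSq φ u x := by
  rw [pretentiousDistSq, pretentiousDistSq, Finset.mul_sum]
  refine Finset.sum_le_sum fun p hp => ?_
  have hpp : p.Prime := Nat.prime_of_mem_primesLE hp
  have hp0 : (0 : ℝ) < p := by exact_mod_cast hpp.pos
  by_cases hpR : p ∈ R
  · rw [hR p hpR, zero_mul, Complex.zero_re, sub_zero, mul_div_assoc', mul_one]
    refine div_le_div_of_nonneg_right ?_ hp0.le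
    linarith [neg_one_le_re_mul_conj (hf p) (hu p)]
  · rw [hRc p hpp hpR, mul_div_assoc']
    refine div_le_div_of_nonneg_right ?_ hp0.le
    linarith [re_mul_conj_le_one (hf p) (hu p)]

/-- **Key inequality** (squared triangle inequality through `f`, made uniform in the sieve): for `φ`
sifted from `f` by `R` and any `1`-bounded `u, v`,
`𝔻(v, u; x)² ≤ 4 𝔻(φ, u; x)² + 2 K_R(x) + 2 (𝔻(f, v; x)² − 𝔻(f, u; x)²)`.
Termwise: off `R` this is `1 − Re(vū) ≤ 2(1 − Re(f v̄)) + 2(1 − Re(f ū))` (`one_sub_re_le_two_mul_add`);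
on `R` the right-hand side is `4 + 2 + 2((1 − Re f v̄) − (1 − Re f ū)) ≥ 2 ≥ 1 − Re(vū)`. [folklore] -/
theorem pretentiousDistSq_le_four_mul_sifted_add (hf : ∀ n, ‖f n‖ ≤ 1) (hu : ∀ n, ‖u n‖ ≤ 1)
    (hv : ∀ n, ‖v n‖ ≤ 1) (hR : ∀ p ∈ R, φ p = 0) (hRc : ∀ p, p.Prime → p ∉ R → φ p = f p) :
    pretentiousDistSq v u x ≤ 4 * pretentiousDistSq φ u x + 2 * (∑ p ∈ (Nat.primesLE ⌊x⌋₊).filter (· ∈ R), 1 / (p : ℝ)) +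
      2 * (pretentiousDistSq f v x - pretentiousDistSq f u x) := by
  simp only [Finset.sum_filter, pretentiousDistSq, Finset.mul_sum, ← Finset.sum_sub_distrib,
    ← Finset.sum_add_distrib]
  refine Finset.sum_le_sum fun p hp => ?_
  have hpp : p.Prime := Nat.prime_of_mem_primesLE hp
  have hp0 : (0 : ℝ) < p := by exact_mod_cast hpp.pos
  have hvu := neg_one_le_re_mul_conj (hv p) (hu p)
  have hfv := re_mul_conj_le_one (hf p) (hv p)
  have hfv' := neg_one_le_re_mul_conj (hf p) (hv p)
  have hfu := re_mul_conj_le_one (hf p) (hu p)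
  have hfu' := neg_one_le_re_mul_conj (hf p) (hu p)
  by_cases hpR : p ∈ R
  · rw [if_pos hpR, hR p hpR, zero_mul, Complex.zero_re, sub_zero]
    have hE : 1 - (v p * conj (u p)).re ≤ 4 * 1 + 2 * 1 +
        2 * ((1 - (f p * conj (v p)).re) - (1 - (f p * conj (u p)).re)) := by linarith
    refine le_of_le_of_eq (div_le_div_of_nonneg_right hE hp0.le) ?_
    ring
  · rw [if_neg hpR, hRc p hpp hpR]
    -- `1 − Re(v ū) ≤ 2(1 − Re(v f̄)) + 2(1 − Re(f ū))` and `Re(v f̄) = Re(f v̄)`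
    have key := one_sub_re_le_two_mul_add (hv p) (hf p) (hu p)
    have hsymm : (v p * conj (f p)).re = (f p * conj (v p)).re := by
      rw [← Complex.conj_re (v p * conj (f p)), map_mul, Complex.conj_conj, mul_comm]
    rw [hsymm] at key
    have hE : 1 - (v p * conj (u p)).re ≤ 4 * (1 - (f p * conj (u p)).re) +
        2 * ((1 - (f p * conj (v p)).re) - (1 - (f p * conj (u p)).re)) := by linarith
    refine le_of_le_of_eq (div_le_div_of_nonneg_right hE hp0.le) ?_
    ring

/-- **Uniform sifted bound**: `𝔻(v, u; x)² ≤ 6 𝔻(φ, u; x)² + 2 (𝔻(f, v; x)² − 𝔻(f, u; x)²)` — the key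
inequality plus `2 K_R ≤ 2 𝔻(φ, u)²`; the sieve `R` no longer appears. [folklore] -/
theorem pretentiousDistSq_le_six_mul_sifted_add (hf : ∀ n, ‖f n‖ ≤ 1) (hu : ∀ n, ‖u n‖ ≤ 1)
    (hv : ∀ n, ‖v n‖ ≤ 1) (hR : ∀ p ∈ R, φ p = 0) (hRc : ∀ p, p.Prime → p ∉ R → φ p = f p) :
    pretentiousDistSq v u x ≤ 6 * pretentiousDistSq φ u x +
      2 * (pretentiousDistSq f v x - pretentiousDistSq f u x) := by
  have h1 := pretentiousDistSq_le_four_mul_sifted_add (x := x) hf hu hv hR hRc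
  have h2 := sum_inv_le_pretentiousDistSq_sifted (x := x) hf hu hR hRc
  linarith

/-! ### Twists `n ↦ n^{it}` and near-minimisers `t₁` -/

/-- **`𝔻(n^{it₁}, n^{it}; x)² = 𝔻(1, n^{i(t−t₁)}; x)²`**: both summands at a prime `p` equal
`(1 − Re p^{i(t₁−t)})/p = (1 − cos((t − t₁) log p))/p`. [folklore] -/
theorem pretentiousDistSq_twist_twist (t₁ t x : ℝ) :
    pretentiousDistSq (fun n : ℕ => (n : ℂ) ^ ((t₁ : ℂ) * I)) (fun n : ℕ => (n : ℂ) ^ ((t : ℂ) * I)) x =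
      pretentiousDistSq 1 (fun n : ℕ => (n : ℂ) ^ (((t - t₁ : ℝ) : ℂ) * I)) x := by
  unfold pretentiousDistSq
  refine Finset.sum_congr rfl fun p hp => ?_
  have hp0 : (p : ℂ) ≠ 0 := by exact_mod_cast (Nat.prime_of_mem_primesLE hp).ne_zero
  have h1 : (p : ℂ) ^ ((t₁ : ℂ) * I) * conj ((p : ℂ) ^ ((t : ℂ) * I)) =
      (p : ℂ) ^ (((t₁ - t : ℝ) : ℂ) * I) := by
    rw [conj_natCast_cpow, ← Complex.cpow_add _ _ hp0]
    congr 1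
    simp only [map_mul, Complex.conj_ofReal, Complex.conj_I]
    push_cast
    ring
  have h2 : (1 : ℕ → ℂ) p * conj ((p : ℂ) ^ (((t - t₁ : ℝ) : ℂ) * I)) =
      (p : ℂ) ^ (((t₁ - t : ℝ) : ℂ) * I) := by
    rw [Pi.one_apply, one_mul, conj_natCast_cpow]
    congr 1
    simp only [map_mul, Complex.conj_ofReal, Complex.conj_I]
    push_cast
    ring
  rw [h1, h2]

/-- **Sifted distances away from a near-minimiser, uniformly in the sieve**: if
`𝔻(f, n^{it₁}; x)² ≤ 𝔻(f, n^{it}; x)² + δ` (e.g. `t₁` a minimiser of `u ↦ 𝔻(f, n^{iu}; x)²` over `|u| ≤ T`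
and `|t| ≤ T`, `δ = 0`), then for every `φ` sifted from `f` (by any `R`),
`𝔻(1, n^{i(t−t₁)}; x)²/6 − δ/3 ≤ 𝔻(φ, n^{it}; x)²`.  (Complex, sieve-uniform substitute for the step
"`2𝔻(f,p^{it}) ≥ 𝔻(1, p^{i(t−t₁)})`" of MRT Appendix A.) [folklore] -/
theorem sifted_twist_ge_sixth (hf : ∀ n, ‖f n‖ ≤ 1) (hR : ∀ p ∈ R, φ p = 0)
    (hRc : ∀ p, p.Prime → p ∉ R → φ p = f p) {t t₁ δ : ℝ}
    (hmin : pretentiousDistSq f (fun n : ℕ => (n : ℂ) ^ ((t₁ : ℂ) * I)) x ≤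
      pretentiousDistSq f (fun n : ℕ => (n : ℂ) ^ ((t : ℂ) * I)) x + δ) :
    pretentiousDistSq 1 (fun n : ℕ => (n : ℂ) ^ (((t - t₁ : ℝ) : ℂ) * I)) x / 6 - δ / 3 ≤
      pretentiousDistSq φ (fun n : ℕ => (n : ℂ) ^ ((t : ℂ) * I)) x := by
  have htw : ∀ (s : ℝ) (n : ℕ), ‖(n : ℂ) ^ ((s : ℂ) * I)‖ ≤ 1 := fun s n => by
    rcases Nat.eq_zero_or_pos n with rfl | hn
    · rcases eq_or_ne ((s : ℂ) * I) 0 with h0 | h0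
      · simp [h0]
      · simp [Complex.zero_cpow h0]
    · rw [Complex.norm_natCast_cpow_of_pos hn]; simp
  have hkey := pretentiousDistSq_le_six_mul_sifted_add (x := x) hf (htw t) (htw t₁) hR hRc
  rw [pretentiousDistSq_twist_twist] at hkey
  linarith

/-- The same with the sieve mass kept (sharper when `K_R` is small, e.g. `R` = the primes of a range
`[P, Q]` with `log(log Q/log P)` small): `𝔻(1, n^{i(t−t₁)}; x)²/4 − K_R(x)/2 − δ/2 ≤ 𝔻(φ, n^{it}; x)²`.
[folklore] -/
theorem sifted_twist_ge_quarter_sub (hf : ∀ n, ‖f n‖ ≤ 1) (hR : ∀ p ∈ R, φ p = 0)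
    (hRc : ∀ p, p.Prime → p ∉ R → φ p = f p) {t t₁ δ : ℝ}
    (hmin : pretentiousDistSq f (fun n : ℕ => (n : ℂ) ^ ((t₁ : ℂ) * I)) x ≤
      pretentiousDistSq f (fun n : ℕ => (n : ℂ) ^ ((t : ℂ) * I)) x + δ) :
    pretentiousDistSq 1 (fun n : ℕ => (n : ℂ) ^ (((t - t₁ : ℝ) : ℂ) * I)) x / 4 -
        (∑ p ∈ (Nat.primesLE ⌊x⌋₊).filter (· ∈ R), 1 / (p : ℝ)) / 2 - δ / 2 ≤
      pretentiousDistSq φ (fun n : ℕ => (n : ℂ) ^ ((t : ℂ) * I)) x := by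
  have htw : ∀ (s : ℝ) (n : ℕ), ‖(n : ℂ) ^ ((s : ℂ) * I)‖ ≤ 1 := fun s n => by
    rcases Nat.eq_zero_or_pos n with rfl | hn
    · rcases eq_or_ne ((s : ℂ) * I) 0 with h0 | h0
      · simp [h0]
      · simp [Complex.zero_cpow h0]
    · rw [Complex.norm_natCast_cpow_of_pos hn]; simp
  have hkey := pretentiousDistSq_le_four_mul_sifted_add (x := x) hf (htw t) (htw t₁) hR hRc
  rw [pretentiousDistSq_twist_twist] at hkey
  linarith

/-- **Complex, sieve-uniform form of Matomäki–Radziwiłł's Lemma 2** (from Ford's bound for `ζ`, through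
`PretentiousFord.pretentiousDistSq_one_twist_ge`): for every `A > 0` there are `x₀, C` such that for all
`x ≥ x₀`, all `1`-bounded `f : ℕ → ℂ`, every `φ` sifted from `f` by any finite set of primes `R`, and all
real `t, t₁, δ` with `𝔻(f, n^{it₁}; x)² ≤ 𝔻(f, n^{it}; x)² + δ` (e.g. `t₁` a minimiser over `|u| ≤ T`,
`|t| ≤ T`, `δ = 0`) and `2 ≤ |t − t₁| ≤ x^A`:
`𝔻(φ, n^{it}; x)² ≥ (1/18) log log x − C − δ/3`.
For real `f` and `R = ∅` compare `PretentiousFord.matomakiRadziwill_lemma2_of_ford` (`1/12`, no `t₁`).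
[folklore] -/
theorem sifted_twist_ge_loglog_of_ford (hF : zeta_bound_ford) {A : ℝ} (hA : 0 < A) :
    ∃ x₀ C : ℝ, 3 ≤ x₀ ∧ ∀ x : ℝ, x₀ ≤ x → ∀ (f φ : ℕ → ℂ) (R : Finset ℕ), (∀ n, ‖f n‖ ≤ 1) →
      (∀ p ∈ R, φ p = 0) → (∀ p, p.Prime → p ∉ R → φ p = f p) → ∀ t t₁ δ : ℝ,
      pretentiousDistSq f (fun n : ℕ => (n : ℂ) ^ ((t₁ : ℂ) * I)) x ≤
        pretentiousDistSq f (fun n : ℕ => (n : ℂ) ^ ((t : ℂ) * I)) x + δ →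
      2 ≤ |t - t₁| → |t - t₁| ≤ x ^ A →
        Real.log (Real.log x) / 18 - C - δ / 3 ≤
          pretentiousDistSq φ (fun n : ℕ => (n : ℂ) ^ ((t : ℂ) * I)) x := by
  obtain ⟨x₀, C, hx₀, h⟩ := PretentiousFord.pretentiousDistSq_one_twist_ge hF hA
  refine ⟨x₀, C / 6, hx₀, fun x hx f φ R hf hR hRc t t₁ δ hmin h2 hxA => ?_⟩
  have hkey := sifted_twist_ge_sixth (x := x) hf hR hRc hmin
  have hford := h x hx (t - t₁) h2 hxA
  linarith

end PretentiousSifted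

end Literature.NumberTheory.LFunctions
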